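import Literature.Algebra.Homology.OrderedCechSystem
import HarnessLib

/-!
# Cuts, predecessors and successors in a finite subset of a linear order (index combinatorics of the ordered Čech
# cup product; Görtz–Wedhorn II, Def. 21.64/21.68; Godement II §6.6)

Pure `Finset` combinatorics used by the front-face/back-face formula of the cup product on ordered (alternating) Čech
cochains (`Algebra/Homology/OrderedCechSystemCup`): for a finite subset `s` of a linearly ordered type and a vertex `v`,

* the LOWER CUT `s_{≤v} = s.filter (· ≤ v)` and the UPPER CUT `s_{≥v} = s.filter (v ≤ ·)` (the front face through `v`
  and the back face from `v`; kept as plain `Finset.filter` expressions, no new definitions), their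
  membership/subset/erase lemmas, and the behaviour of the Čech sign
  `OrderedCech.sign A s a = (-1)^{#{b ∈ s | b < a}}` (`Algebra/Homology/OrderedCech`) on the two cuts
  (`sign_lowerCut_of_le`, `sign_lowerCut_self`, `sign_upperCut_self`, `sign_eq_pow_mul_sign_upperCut`);
* the predecessor `(s.filter (· < v)).max'` / successor `(s.filter (w < ·)).min'` of a vertex inside `s`, with
  `succ_pred`, `pred_succ` and the identification of the cuts at consecutive vertices
  (`filter_lt_eq_lowerCut_pred`, `upperCut_eq_filter_lt_pred`, `filter_gt_eq_upperCut_succ`,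
  `lowerCut_eq_filter_lt_succ`) — the reindexing behind the cancellation of the diagonal terms in the Leibniz rule;
* a complement to `Algebra/Homology/OrderedCechSystem.ext0At_sysD`: the same formula
  `(d g).ext0At s t = Σ_{a ∈ s} ε(s,a) • g.ext0At (s ∖ a) t` without the hypothesis `#s ≥ 2`, in degree `n ≥ 0`
  (`ext0At_sysD_of_nonneg`).

Everything is elementary and proved; THEOREMS ONLY (no definition, no named fact, no instance).  Mathlib searched (pin v4.32): `Finset.filter_erase`,
`Finset.max'`/`min'`, `Finset.orderEmbOfFin` (not needed: the cuts avoid enumerating vertices).  Library only (cell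
hodgecm-mathlib, FLOOR-0 P1 F-11 road A); HC_CM is proved only modulo the 7 printed citations until rung 0 closes, and
nothing here bears on it.

## References

* [GortzWedhorn2023] U. Görtz, T. Wedhorn, *Algebraic Geometry II: Cohomology of Schemes* (2023), Def. 21.64 and
  Def. 21.68 (pp. 179–180: the signs of the ordered Čech differential).
* [Godement1958] R. Godement, *Topologie algébrique et théorie des faisceaux* (1958), II §6.6 (front and back faces).
-/

universe v u

open CategoryTheory

set_option backward.isDefEq.respectTransparency false

noncomputable section

namespace Literature.Algebra.Homology

namespace OrderedCech

variable {ι : Type} [LinearOrder ι]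
/-! ### Lower and upper cuts of a finite set at a vertex -/

section Cuts

/-- Membership in the lower cut `s_{≤v} = {i ∈ s | i ≤ v}` (the front face through `v`).
[folklore] [cite: GortzWedhorn2023, Def. 21.68 (p. 180)] -/
theorem mem_lowerCut {s : Finset ι} {v i : ι} : i ∈ Finset.filter (· ≤ v) s ↔ i ∈ s ∧ i ≤ v := Finset.mem_filter

/-- Membership in the upper cut `s_{≥v} = {i ∈ s | v ≤ i}` (the back face from `v`).
[folklore] [cite: GortzWedhorn2023, Def. 21.68 (p. 180)] -/
theorem mem_upperCut {s : Finset ι} {v i : ι} : i ∈ Finset.filter (v ≤ ·) s ↔ i ∈ s ∧ v ≤ i := Finset.mem_filter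

/-- `s_{≤v} ⊆ s`. [folklore] [cite: GortzWedhorn2023, Def. 21.68 (p. 180)] -/
theorem lowerCut_subset (s : Finset ι) (v : ι) : Finset.filter (· ≤ v) s ⊆ s := Finset.filter_subset _ _

/-- `s_{≥v} ⊆ s`. [folklore] [cite: GortzWedhorn2023, Def. 21.68 (p. 180)] -/
theorem upperCut_subset (s : Finset ι) (v : ι) : Finset.filter (v ≤ ·) s ⊆ s := Finset.filter_subset _ _

/-- `v ∈ s_{≤v}` for `v ∈ s`. [folklore] [cite: GortzWedhorn2023, Def. 21.68 (p. 180)] -/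
theorem self_mem_lowerCut {s : Finset ι} {v : ι} (hv : v ∈ s) : v ∈ Finset.filter (· ≤ v) s :=
  mem_lowerCut.2 ⟨hv, le_rfl⟩

/-- `v ∈ s_{≥v}` for `v ∈ s`. [folklore] [cite: GortzWedhorn2023, Def. 21.68 (p. 180)] -/
theorem self_mem_upperCut {s : Finset ι} {v : ι} (hv : v ∈ s) : v ∈ Finset.filter (v ≤ ·) s :=
  mem_upperCut.2 ⟨hv, le_rfl⟩

/-- Cutting commutes with erasing a vertex: `(s ∖ a)_{≤v} = s_{≤v} ∖ a`. [folklore] [cite: GortzWedhorn2023, Def. 21.68 (p. 180)] -/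
theorem lowerCut_erase [DecidableEq ι] (s : Finset ι) (a v : ι) :
    Finset.filter (· ≤ v) (s.erase a) = (Finset.filter (· ≤ v) s).erase a :=
  Finset.filter_erase _ _ _

/-- Cutting commutes with erasing a vertex: `(s ∖ a)_{≥v} = s_{≥v} ∖ a`. [folklore] [cite: GortzWedhorn2023, Def. 21.68 (p. 180)] -/
theorem upperCut_erase [DecidableEq ι] (s : Finset ι) (a v : ι) :
    Finset.filter (v ≤ ·) (s.erase a) = (Finset.filter (v ≤ ·) s).erase a :=
  Finset.filter_erase _ _ _

/-- Erasing a vertex above the cut does not change the lower cut. [folklore] [cite: GortzWedhorn2023, Def. 21.68 (p. 180)] -/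
theorem lowerCut_erase_of_lt [DecidableEq ι] (s : Finset ι) {a v : ι} (h : v < a) :
    (Finset.filter (· ≤ v) s).erase a = Finset.filter (· ≤ v) s :=
  Finset.erase_eq_of_notMem fun ha => (not_le.2 h) (mem_lowerCut.1 ha).2

/-- Erasing a vertex below the cut does not change the upper cut. [folklore] [cite: GortzWedhorn2023, Def. 21.68 (p. 180)] -/
theorem upperCut_erase_of_lt [DecidableEq ι] (s : Finset ι) {a v : ι} (h : a < v) :
    (Finset.filter (v ≤ ·) s).erase a = Finset.filter (v ≤ ·) s :=
  Finset.erase_eq_of_notMem fun ha => (not_le.2 h) (mem_upperCut.1 ha).2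

/-- The strict lower part `{b ∈ s | b < v}` of `s` is the strict lower part of the lower cut `s_{≤v}` below `v`.
[folklore] [cite: GortzWedhorn2023, Def. 21.68 (p. 180)] -/
theorem filter_lt_lowerCut_self (s : Finset ι) (v : ι) : (Finset.filter (· ≤ v) s).filter (· < v) = s.filter (· < v) := by
  ext b
  simp only [Finset.mem_filter]
  exact ⟨fun h => ⟨h.1.1, h.2⟩, fun h => ⟨⟨h.1, le_of_lt h.2⟩, h.2⟩⟩

/-- Below a vertex `a ≤ v` the lower cut and `s` have the same elements `< a`. [folklore] [cite: GortzWedhorn2023, Def. 21.68 (p. 180)] -/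
theorem filter_lt_lowerCut_of_le (s : Finset ι) {a v : ι} (hav : a ≤ v) :
    (Finset.filter (· ≤ v) s).filter (· < a) = s.filter (· < a) := by
  ext b
  simp only [Finset.mem_filter]
  exact ⟨fun h => ⟨h.1.1, h.2⟩, fun h => ⟨⟨h.1, (le_of_lt h.2).trans hav⟩, h.2⟩⟩

/-- Nothing in the upper cut `s_{≥v}` lies strictly below `v`. [folklore] [cite: GortzWedhorn2023, Def. 21.68 (p. 180)] -/
theorem filter_lt_upperCut_self (s : Finset ι) (v : ι) : (Finset.filter (v ≤ ·) s).filter (· < v) = ∅ := by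
  ext b
  simp only [Finset.mem_filter, Finset.notMem_empty, iff_false, not_and, not_lt]
  exact fun h => h.2

/-- For `v ≤ a`, the elements of `s` below `a` are those below `v` together with those of `s_{≥v}` below `a`.
[folklore] [cite: GortzWedhorn2023, Def. 21.68 (p. 180)] -/
theorem card_filter_lt_eq_add_of_le (s : Finset ι) {a v : ι} (hva : v ≤ a) :
    (s.filter (· < a)).card = (s.filter (· < v)).card + ((Finset.filter (v ≤ ·) s).filter (· < a)).card := by
  classical
  have hsplit : s.filter (· < a) = s.filter (· < v) ∪ (Finset.filter (v ≤ ·) s).filter (· < a) := by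
    ext b
    simp only [Finset.mem_union, Finset.mem_filter]
    constructor
    · intro h
      by_cases hbv : b < v
      · exact Or.inl ⟨h.1, hbv⟩
      · exact Or.inr ⟨⟨h.1, not_lt.1 hbv⟩, h.2⟩
    · rintro (h | h)
      · exact ⟨h.1, lt_of_lt_of_le h.2 hva⟩
      · exact ⟨h.1.1, h.2⟩
  have hdisj : Disjoint (s.filter (· < v)) ((Finset.filter (v ≤ ·) s).filter (· < a)) := by
    rw [Finset.disjoint_left]
    intro b hb hb'
    exact (not_le.2 (Finset.mem_filter.1 hb).2) (mem_upperCut.1 (Finset.mem_filter.1 hb').1).2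
  rw [hsplit, Finset.card_union_of_disjoint hdisj]

variable {A : Type u} [CommRing A]

/-- The sign of a vertex `a ≤ v` in the front face `s_{≤v}` is its sign in `s`. [folklore] [cite: GortzWedhorn2023, Def. 21.68 (p. 180)] -/
theorem sign_lowerCut_of_le (s : Finset ι) {a v : ι} (hav : a ≤ v) : sign A (Finset.filter (· ≤ v) s) a = sign A s a := by
  unfold sign
  rw [filter_lt_lowerCut_of_le s hav]

/-- The sign of the top vertex `v` of the front face `s_{≤v}` is `(-1)^{#{b ∈ s | b < v}}`. [folklore] [cite: GortzWedhorn2023, Def. 21.68 (p. 180)] -/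
theorem sign_lowerCut_self (s : Finset ι) (v : ι) : sign A (Finset.filter (· ≤ v) s) v = (-1) ^ (s.filter (· < v)).card := by
  unfold sign
  rw [filter_lt_lowerCut_self]

/-- The sign of the bottom vertex `v` of the back face `s_{≥v}` is `1`. [folklore] [cite: GortzWedhorn2023, Def. 21.68 (p. 180)] -/
theorem sign_upperCut_self (s : Finset ι) (v : ι) : sign A (Finset.filter (v ≤ ·) s) v = 1 := by
  unfold sign
  rw [filter_lt_upperCut_self, Finset.card_empty, pow_zero]

/-- The sign of a vertex `a ≥ v` in `s` is `(-1)^{#{b ∈ s | b < v}}` times its sign in the back face `s_{≥v}`.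
[folklore] [cite: GortzWedhorn2023, Def. 21.68 (p. 180)] -/
theorem sign_eq_pow_mul_sign_upperCut (s : Finset ι) {a v : ι} (hva : v ≤ a) :
    sign A s a = (-1) ^ (s.filter (· < v)).card * sign A (Finset.filter (v ≤ ·) s) a := by
  unfold sign
  rw [card_filter_lt_eq_add_of_le s hva, pow_add]

end Cuts

/-! ### Predecessors and successors inside a finite set -/

section PredSucc

/-! The PREDECESSOR of a vertex `v` in `s` is `(s.filter (· < v)).max'`, the SUCCESSOR of `w` is
`(s.filter (w < ·)).min'` (when the strict lower / upper part is non-empty); no separate definitions. -/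

/-- `pred s v ∈ s` and `pred s v < v`. [folklore] [cite: GortzWedhorn2023, Def. 21.68 (p. 180)] -/
theorem pred_mem_lt (s : Finset ι) (v : ι) (h : (s.filter (· < v)).Nonempty) : (Finset.filter (· < v) s).max' h ∈ s ∧ (Finset.filter (· < v) s).max' h < v :=
  Finset.mem_filter.1 (Finset.max'_mem _ h)

/-- `succ s w ∈ s` and `w < succ s w`. [folklore] [cite: GortzWedhorn2023, Def. 21.68 (p. 180)] -/
theorem succ_mem_lt (s : Finset ι) (w : ι) (h : (s.filter (w < ·)).Nonempty) : (Finset.filter (w < ·) s).min' h ∈ s ∧ w < (Finset.filter (w < ·) s).min' h :=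
  Finset.mem_filter.1 (Finset.min'_mem _ h)

/-- No element of `s` lies strictly between `pred s v` and `v`. [folklore] [cite: GortzWedhorn2023, Def. 21.68 (p. 180)] -/
theorem not_mem_of_pred_lt_lt (s : Finset ι) (v : ι) (h : (s.filter (· < v)).Nonempty) {b : ι} (hb : b ∈ s)
    (h1 : (Finset.filter (· < v) s).max' h < b) (h2 : b < v) : False :=
  (not_le.2 h1) (Finset.le_max' _ b (Finset.mem_filter.2 ⟨hb, h2⟩))

/-- No element of `s` lies strictly between `w` and `succ s w`. [folklore] [cite: GortzWedhorn2023, Def. 21.68 (p. 180)] -/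
theorem not_mem_of_lt_lt_succ (s : Finset ι) (w : ι) (h : (s.filter (w < ·)).Nonempty) {b : ι} (hb : b ∈ s)
    (h1 : w < b) (h2 : b < (Finset.filter (w < ·) s).min' h) : False :=
  (not_le.2 h2) (Finset.min'_le _ b (Finset.mem_filter.2 ⟨hb, h1⟩))

/-- The strict lower part below `v` is the lower cut at the predecessor. [folklore] [cite: GortzWedhorn2023, Def. 21.68 (p. 180)] -/
theorem filter_lt_eq_lowerCut_pred (s : Finset ι) (v : ι) (h : (s.filter (· < v)).Nonempty) :
    s.filter (· < v) = Finset.filter (· ≤ ((Finset.filter (· < v) s).max' h)) s := by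
  ext b
  simp only [Finset.mem_filter]
  constructor
  · intro hb
    exact ⟨hb.1, Finset.le_max' _ b (Finset.mem_filter.2 hb)⟩
  · intro hb
    exact ⟨hb.1, lt_of_le_of_lt hb.2 (pred_mem_lt s v h).2⟩

/-- The upper cut at `v` is the strict upper part above the predecessor of `v`. [folklore] [cite: GortzWedhorn2023, Def. 21.68 (p. 180)] -/
theorem upperCut_eq_filter_lt_pred (s : Finset ι) {v : ι} (h : (s.filter (· < v)).Nonempty) :
    Finset.filter (v ≤ ·) s = s.filter ((Finset.filter (· < v) s).max' h < ·) := by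
  ext b
  simp only [Finset.mem_filter]
  constructor
  · intro hb
    exact ⟨hb.1, lt_of_lt_of_le (pred_mem_lt s v h).2 hb.2⟩
  · intro hb
    refine ⟨hb.1, ?_⟩
    by_contra hlt
    exact not_mem_of_pred_lt_lt s v h hb.1 hb.2 (not_le.1 hlt)

/-- The strict upper part above `w` is the upper cut at the successor. [folklore] [cite: GortzWedhorn2023, Def. 21.68 (p. 180)] -/
theorem filter_gt_eq_upperCut_succ (s : Finset ι) (w : ι) (h : (s.filter (w < ·)).Nonempty) :
    s.filter (w < ·) = Finset.filter (((Finset.filter (w < ·) s).min' h) ≤ ·) s := by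
  ext b
  simp only [Finset.mem_filter]
  constructor
  · intro hb
    exact ⟨hb.1, Finset.min'_le _ b (Finset.mem_filter.2 hb)⟩
  · intro hb
    exact ⟨hb.1, lt_of_lt_of_le (succ_mem_lt s w h).2 hb.2⟩

/-- The lower cut at `w` is the strict lower part below the successor of `w`. [folklore] [cite: GortzWedhorn2023, Def. 21.68 (p. 180)] -/
theorem lowerCut_eq_filter_lt_succ (s : Finset ι) {w : ι} (h : (s.filter (w < ·)).Nonempty) :
    Finset.filter (· ≤ w) s = s.filter (· < (Finset.filter (w < ·) s).min' h) := by
  ext b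
  simp only [Finset.mem_filter]
  constructor
  · intro hb
    exact ⟨hb.1, lt_of_le_of_lt hb.2 (succ_mem_lt s w h).2⟩
  · intro hb
    refine ⟨hb.1, ?_⟩
    by_contra hlt
    exact not_mem_of_lt_lt_succ s w h hb.1 (not_le.1 hlt) hb.2

/-- `succ (pred v) = v` for `v ∈ s`. [folklore] [cite: GortzWedhorn2023, Def. 21.68 (p. 180)] -/
theorem succ_pred (s : Finset ι) {v : ι} (hv : v ∈ s) (h : (s.filter (· < v)).Nonempty)
    (h' : (s.filter ((Finset.filter (· < v) s).max' h < ·)).Nonempty) : (Finset.filter ((Finset.filter (· < v) s).max' h < ·) s).min' h' = v := by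
  apply le_antisymm
  · exact Finset.min'_le _ v (Finset.mem_filter.2 ⟨hv, (pred_mem_lt s v h).2⟩)
  · by_contra hlt
    exact not_mem_of_pred_lt_lt s v h (succ_mem_lt s _ h').1 (succ_mem_lt s _ h').2 (not_le.1 hlt)

/-- `pred (succ w) = w` for `w ∈ s`. [folklore] [cite: GortzWedhorn2023, Def. 21.68 (p. 180)] -/
theorem pred_succ (s : Finset ι) {w : ι} (hw : w ∈ s) (h : (s.filter (w < ·)).Nonempty)
    (h' : (s.filter (· < (Finset.filter (w < ·) s).min' h)).Nonempty) : (Finset.filter (· < ((Finset.filter (w < ·) s).min' h)) s).max' h' = w := by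
  apply le_antisymm
  · by_contra hlt
    exact not_mem_of_lt_lt_succ s w h (pred_mem_lt s _ h').1 (not_le.1 hlt) (pred_mem_lt s _ h').2
  · exact Finset.le_max' _ w (Finset.mem_filter.2 ⟨hw, (succ_mem_lt s w h).2⟩)

end PredSucc

/-! ### A complement on the differential of a system: `ext0At` of `d g` in non-negative degree -/

section Differential

variable {A : Type u} [CommRing A] {M : Finset ι ⥤ ModuleCat.{v} A}

/-- `ext0At` of a differential, without the cardinality hypothesis of `ext0At_sysD` but in non-negative degree:
`(d g).ext0At s t = Σ_{a ∈ s} ε(s, a) • g.ext0At (s ∖ a) t` for `s ⊆ t`, `n ≥ 0`. [folklore] [cite: GortzWedhorn2023, Def. 21.68 (p. 180)] -/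
theorem ext0At_sysD_of_nonneg (n : ℤ) (hn : 0 ≤ n) (g : SysCochain M n) (s t : Finset ι) (hst : s ⊆ t) :
    (sysD M n g).ext0At s t = ∑ a ∈ s, sign A s a • g.ext0At (s.erase a) t := by
  classical
  by_cases hs : 2 ≤ s.card
  · exact ext0At_sysD M n g s t hst hs
  · -- `s` has at most one element: both sides vanish
    have hl : (sysD M n g).ext0At s t = 0 := by
      unfold SysCochain.ext0At
      rw [dif_neg]
      rintro ⟨⟨_, hc⟩, _⟩
      omega
    rw [hl, eq_comm]
    refine Finset.sum_eq_zero fun a ha => ?_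
    have he : ¬ ((s.erase a).Nonempty ∧ ((s.erase a).card : ℤ) = n + 1) := by
      rintro ⟨hne, _⟩
      have := Finset.card_erase_of_mem ha
      have hpos := hne.card_pos
      omega
    unfold SysCochain.ext0At
    rw [dif_neg (fun h => he h.1), smul_zero]

end Differential

end OrderedCech

end Literature.Algebra.Homology

end
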